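import Summits.KontsevichZagierPeriods.KontsevichZagierPeriods.Theorems.FurushoPentagonPentagonInKZCornerEngineExistAux
import Summits.KontsevichZagierPeriods.KontsevichZagierPeriods.Theorems.FurushoPentagonPentagonInKZCornerEngineExistAdm
import Summits.KontsevichZagierPeriods.KontsevichZagierPeriods.Theorems.FurushoPentagonPentagonInKZCornerEngineExistEAux

/-!
# `PentagonInKZ`, line `edge-normal-newton-leibniz`: corner engine — the bounded families of Step A exist

Part of the proof of `cornerEngine_uniformlyNull` (crux `FurushoPentagon.PentagonInKZ`,
stmt-KontsevichZagierPeriods-11348), in the ABSTRACT form of the corner engine: all objects (residues `Zq`,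
residue monomials `wZ`, letter densities `fd`, `gd`, `dd`, regularised word integrands `Ht`, `Vt`,
`dHt`, `dVt`, insertion operators `op`, `opV`, transports `Af`, `Bf`, `dAf`, `dBf`, defect `F`,
coordinate blocks `Xb | Yb | Θb`) are hypothesised, and their properties form ONE hypothesis
bundle `H`.  This file establishes the EXISTENCE of the bounded families of Step A of the engine (integral
representations on closed unit cubes whose integrands are semialgebraic and bounded on the cube):

* `abs_mul_mul_le` — a three-factor bound;
* `exists_stepA_bdd` — the IH family `P a` (weight `σ_a`, defect `F^{μ ∘ op a}` at `(Ξ₁, Η₁)`), the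
  `dd`-terms `W₁ a` and the `dB`-terms `W₂ a` (letters `a ≠ ℓ`), and the IH families `Φ c`,
  `Φ₂ a b` of the two collections at level `e + 2` (the defect is `O(ξ η)`, which absorbs the
  poles `1/Ξ₂`, `1/Η₂` of the regularised letters).

References: [KontsevichZagier2001, §1.1–1.2], [BochnakCosteRoy1998, Prop. 2.2.6], [Drinfeld1991, §2].
-/

noncomputable section

open Set MeasureTheory
open Literature.NumberTheory.Transcendental
open Literature.ModelTheory.ExponentialFields (IsSemialgebraic)

namespace Summit.KontsevichZagierPeriods.FurushoPentagon.PentagonInKZ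

section AbstractEngine

variable {m N : ℕ} {ℓ ℓ' : Fin (m + 2)} {α β : ℚ}
  {Zq : Fin (m + 2) → (DrinfeldKohnoTrunc ℚ (Fin 4) N)} {wZ : ∀ {n : ℕ}, (Fin n → Fin (m + 2)) → (DrinfeldKohnoTrunc ℚ (Fin 4) N)}
  {fd gd dd : Fin (m + 2) → ℝ → ℝ → ℝ}
  {Ht Vt dHt dVt : ∀ {n : ℕ}, (Fin n → Fin (m + 2)) → (Fin n → ℝ) → ℝ → ℝ → ℝ}
  {op opV : Fin (m + 2) → (DrinfeldKohnoTrunc ℚ (Fin 4) N) →ₗ[ℚ] (DrinfeldKohnoTrunc ℚ (Fin 4) N)}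
  {Af Bf dAf dBf F : ((DrinfeldKohnoTrunc ℚ (Fin 4) N) →ₗ[ℚ] ℚ) → ∀ {k l : ℕ}, (Fin k → ℝ) → (Fin l → ℝ) → ℝ → ℝ → ℝ}
  {Xb : ∀ k l e : ℕ, (Fin (k + l + e) → ℝ) → Fin k → ℝ}
  {Yb : ∀ k l e : ℕ, (Fin (k + l + e) → ℝ) → Fin l → ℝ}
  {Θb : ∀ k l e : ℕ, (Fin (k + l + e) → ℝ) → Fin e → ℝ}

variable (H :
    (∀ {n : ℕ} (U : Fin n → Fin (m + 2)), wZ U = ((List.ofFn U).map Zq).prod) ∧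
    (∀ (a : Fin (m + 2)) (X : (DrinfeldKohnoTrunc ℚ (Fin 4) N)), op a X = if a = ℓ then Zq ℓ * X - X * Zq ℓ else Zq a * X) ∧
    (∀ (b : Fin (m + 2)) (X : (DrinfeldKohnoTrunc ℚ (Fin 4) N)), opV b X = if b = ℓ' then Zq ℓ' * X - X * Zq ℓ' else Zq b * X) ∧
    (∀ (μ : (DrinfeldKohnoTrunc ℚ (Fin 4) N) →ₗ[ℚ] ℚ) {k l : ℕ} (x : Fin k → ℝ) (y : Fin l → ℝ) (ξ η : ℝ), Af μ x y ξ η = ∑ U : Fin k → Fin (m + 2), ∑ V : Fin l → Fin (m + 2), (μ (wZ U * wZ V) : ℝ) * (Ht U x ξ η * Vt V y 0 η)) ∧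
    (∀ (μ : (DrinfeldKohnoTrunc ℚ (Fin 4) N) →ₗ[ℚ] ℚ) {k l : ℕ} (x : Fin k → ℝ) (y : Fin l → ℝ) (ξ η : ℝ), Bf μ x y ξ η = ∑ U : Fin k → Fin (m + 2), ∑ V : Fin l → Fin (m + 2), (μ (wZ V * wZ U) : ℝ) * (Vt V y ξ η * Ht U x ξ 0)) ∧
    (∀ (μ : (DrinfeldKohnoTrunc ℚ (Fin 4) N) →ₗ[ℚ] ℚ) {k l : ℕ} (x : Fin k → ℝ) (y : Fin l → ℝ) (ξ η : ℝ), dAf μ x y ξ η = ∑ U : Fin k → Fin (m + 2), ∑ V : Fin l → Fin (m + 2), (μ (wZ U * wZ V) : ℝ) * (dHt U x ξ η * Vt V y 0 η)) ∧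
    (∀ (μ : (DrinfeldKohnoTrunc ℚ (Fin 4) N) →ₗ[ℚ] ℚ) {k l : ℕ} (x : Fin k → ℝ) (y : Fin l → ℝ) (ξ η : ℝ), dBf μ x y ξ η = ∑ U : Fin k → Fin (m + 2), ∑ V : Fin l → Fin (m + 2), (μ (wZ V * wZ U) : ℝ) * (dVt V y ξ η * Ht U x ξ 0)) ∧
    (∀ (μ : (DrinfeldKohnoTrunc ℚ (Fin 4) N) →ₗ[ℚ] ℚ) {k l : ℕ} (x : Fin k → ℝ) (y : Fin l → ℝ) (ξ η : ℝ), F μ x y ξ η = Af μ x y ξ η - Bf μ x y ξ η) ∧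
    (∀ (k l e : ℕ) (z : Fin (k + l + e) → ℝ), Xb k l e z = fun i => z (Fin.castAdd e (Fin.castAdd l i))) ∧
    (∀ (k l e : ℕ) (z : Fin (k + l + e) → ℝ), Yb k l e z = fun j => z (Fin.castAdd e (Fin.natAdd k j))) ∧
    (∀ (k l e : ℕ) (z : Fin (k + l + e) → ℝ), Θb k l e z = fun s => z (Fin.natAdd (k + l) s)) ∧
    (∀ (U : Fin 0 → Fin (m + 2)) (x : Fin 0 → ℝ) (ξ η : ℝ), Ht U x ξ η = 1) ∧
    (∀ (V : Fin 0 → Fin (m + 2)) (y : Fin 0 → ℝ) (ξ η : ℝ), Vt V y ξ η = 1) ∧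
    (∀ (U : Fin 0 → Fin (m + 2)) (x : Fin 0 → ℝ) (ξ η : ℝ), dHt U x ξ η = 0) ∧
    (∀ (V : Fin 0 → Fin (m + 2)) (y : Fin 0 → ℝ) (ξ η : ℝ), dVt V y ξ η = 0) ∧
    (∀ {k : ℕ} (U : Fin (k + 1) → Fin (m + 2)) (x : Fin (k + 1) → ℝ) (η : ℝ), Ht U x 0 η = 0) ∧
    (∀ {l : ℕ} (V : Fin (l + 1) → Fin (m + 2)) (y : Fin (l + 1) → ℝ) (ξ : ℝ), Vt V y ξ 0 = 0) ∧
    (∀ t y : ℝ, fd ℓ t y = 1 / t) ∧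
    (∀ x s : ℝ, gd ℓ' x s = 1 / s) ∧
    (∀ x y : ℝ, dd ℓ x y = 0) ∧
    (∀ x y : ℝ, dd ℓ' x y = 0) ∧
    (∀ (μ : (DrinfeldKohnoTrunc ℚ (Fin 4) N) →ₗ[ℚ] ℚ) {k : ℕ} (x₀ : ℝ) (x' : Fin k → ℝ) (ξ η : ℝ), ∑ U : Fin (k + 1) → Fin (m + 2), (μ (wZ U) : ℝ) * Ht U (Fin.cons x₀ x') ξ η = (∑ a : Fin (m + 2), (if a = ℓ then 1 / x₀ else ξ * fd a (ξ * x₀) η) * ∑ U' : Fin k → Fin (m + 2), (μ (Zq a * wZ U') : ℝ) * Ht U' x' (ξ * x₀) η) - (1 / x₀) * ∑ U' : Fin k → Fin (m + 2), (μ (wZ U' * Zq ℓ) : ℝ) * Ht U' x' (ξ * x₀) η) ∧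
    (∀ (μ : (DrinfeldKohnoTrunc ℚ (Fin 4) N) →ₗ[ℚ] ℚ) {l : ℕ} (y₀ : ℝ) (y' : Fin l → ℝ) (ξ η : ℝ), ∑ V : Fin (l + 1) → Fin (m + 2), (μ (wZ V) : ℝ) * Vt V (Fin.cons y₀ y') ξ η = (∑ b : Fin (m + 2), (if b = ℓ' then 1 / y₀ else η * gd b ξ (η * y₀)) * ∑ V' : Fin l → Fin (m + 2), (μ (Zq b * wZ V') : ℝ) * Vt V' y' ξ (η * y₀)) - (1 / y₀) * ∑ V' : Fin l → Fin (m + 2), (μ (wZ V' * Zq ℓ') : ℝ) * Vt V' y' ξ (η * y₀)) ∧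
    (∀ (μ : (DrinfeldKohnoTrunc ℚ (Fin 4) N) →ₗ[ℚ] ℚ) {l : ℕ} (P Q : (DrinfeldKohnoTrunc ℚ (Fin 4) N)) (y : Fin l → ℝ) (η : ℝ), (∀ i, 0 < y i ∧ y i < 1) → 0 < η → η ≤ (β : ℝ) → ∑ V : Fin l → Fin (m + 2), (μ (P * (Zq ℓ * wZ V - wZ V * Zq ℓ) * Q) : ℝ) * Vt V y 0 η = 0) ∧
    (∀ (μ : (DrinfeldKohnoTrunc ℚ (Fin 4) N) →ₗ[ℚ] ℚ) {k : ℕ} (P Q : (DrinfeldKohnoTrunc ℚ (Fin 4) N)) (x : Fin k → ℝ) (ξ : ℝ), (∀ i, 0 < x i ∧ x i < 1) → 0 < ξ → ξ ≤ (α : ℝ) → ∑ U : Fin k → Fin (m + 2), (μ (P * (Zq ℓ' * wZ U - wZ U * Zq ℓ') * Q) : ℝ) * Ht U x ξ 0 = 0) ∧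
    (∀ (μ : (DrinfeldKohnoTrunc ℚ (Fin 4) N) →ₗ[ℚ] ℚ) (P Q : (DrinfeldKohnoTrunc ℚ (Fin 4) N)), μ (P * (Zq ℓ * Zq ℓ' - Zq ℓ' * Zq ℓ) * Q) = 0) ∧
    (∀ (μ : (DrinfeldKohnoTrunc ℚ (Fin 4) N) →ₗ[ℚ] ℚ) (P Q : (DrinfeldKohnoTrunc ℚ (Fin 4) N)) (x y : ℝ), 0 < x → x < (α : ℝ) → 0 < y → y < (β : ℝ) → ∑ a : Fin (m + 2), ∑ b : Fin (m + 2), (fd a x y * gd b x y) * (μ (P * (Zq a * Zq b - Zq b * Zq a) * Q) : ℝ) = 0) ∧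
    (∀ (μ : (DrinfeldKohnoTrunc ℚ (Fin 4) N) →ₗ[ℚ] ℚ) (P Q : (DrinfeldKohnoTrunc ℚ (Fin 4) N)) (s : ℝ), 0 < s → s < (β : ℝ) → ∑ b : Fin (m + 2), gd b 0 s * (μ (P * (Zq ℓ * Zq b - Zq b * Zq ℓ) * Q) : ℝ) = 0) ∧
    (∀ (μ : (DrinfeldKohnoTrunc ℚ (Fin 4) N) →ₗ[ℚ] ℚ) (P Q : (DrinfeldKohnoTrunc ℚ (Fin 4) N)) (t : ℝ), 0 < t → t < (α : ℝ) → ∑ a : Fin (m + 2), fd a t 0 * (μ (P * (Zq ℓ' * Zq a - Zq a * Zq ℓ') * Q) : ℝ) = 0) ∧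
    (∀ (a : Fin (m + 2)) (ξ η : ℝ), 0 ≤ ξ → ξ ≤ (α : ℝ) → 0 ≤ η → η ≤ (β : ℝ) → HasDerivAt (fun y => fd a ξ y) (dd a ξ η) η) ∧
    (∀ (b : Fin (m + 2)) (ξ η : ℝ), 0 ≤ ξ → ξ ≤ (α : ℝ) → 0 ≤ η → η ≤ (β : ℝ) → HasDerivAt (fun x => gd b x η) (dd b ξ η) ξ) ∧
    (∀ {k : ℕ} (U : Fin k → Fin (m + 2)) (x : Fin k → ℝ) (ξ η : ℝ), (∀ i, 0 ≤ x i ∧ x i ≤ 1) → 0 ≤ ξ → ξ ≤ (α : ℝ) → 0 ≤ η → η ≤ (β : ℝ) → HasDerivAt (fun t => Ht U x t η) (dHt U x ξ η) ξ) ∧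
    (∀ {l : ℕ} (V : Fin l → Fin (m + 2)) (y : Fin l → ℝ) (ξ η : ℝ), (∀ i, 0 ≤ y i ∧ y i ≤ 1) → 0 ≤ ξ → ξ ≤ (α : ℝ) → 0 ≤ η → η ≤ (β : ℝ) → HasDerivAt (fun s => Vt V y ξ s) (dVt V y ξ η) η) ∧
    (∀ {k : ℕ} (U : Fin (k + 1) → Fin (m + 2)) (x₀ : ℝ) (x' : Fin k → ℝ) (ξ η : ℝ), 0 < x₀ → x₀ < 1 → (∀ i, 0 ≤ x' i ∧ x' i ≤ 1) → 0 ≤ ξ → ξ ≤ (α : ℝ) → 0 ≤ η → η ≤ (β : ℝ) → HasDerivAt (fun t => t * Ht U (Fin.cons t x') ξ η) (ξ * dHt U (Fin.cons x₀ x') ξ η) x₀) ∧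
    (∀ {l : ℕ} (V : Fin (l + 1) → Fin (m + 2)) (y₀ : ℝ) (y' : Fin l → ℝ) (ξ η : ℝ), 0 < y₀ → y₀ < 1 → (∀ i, 0 ≤ y' i ∧ y' i ≤ 1) → 0 ≤ ξ → ξ ≤ (α : ℝ) → 0 ≤ η → η ≤ (β : ℝ) → HasDerivAt (fun t => t * Vt V (Fin.cons t y') ξ η) (η * dVt V (Fin.cons y₀ y') ξ η) y₀) ∧
    (∀ {k : ℕ} (U : Fin (k + 1) → Fin (m + 2)) (x' : Fin k → ℝ) (ξ η : ℝ), (∀ i, 0 ≤ x' i ∧ x' i ≤ 1) → 0 ≤ ξ → ξ ≤ (α : ℝ) → 0 ≤ η → η ≤ (β : ℝ) → ContinuousOn (fun t => t * Ht U (Fin.cons t x') ξ η) (Set.Icc 0 1)) ∧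
    (∀ {l : ℕ} (V : Fin (l + 1) → Fin (m + 2)) (y' : Fin l → ℝ) (ξ η : ℝ), (∀ i, 0 ≤ y' i ∧ y' i ≤ 1) → 0 ≤ ξ → ξ ≤ (α : ℝ) → 0 ≤ η → η ≤ (β : ℝ) → ContinuousOn (fun t => t * Vt V (Fin.cons t y') ξ η) (Set.Icc 0 1)) ∧
    (∀ {d : ℕ} {W : Set (Fin d → ℝ)}, IsSemialgebraic ℚ W → ∀ (a : Fin (m + 2)) {T Y : (Fin d → ℝ) → ℝ}, IsSemialgebraicFunOn ℚ W T → IsSemialgebraicFunOn ℚ W Y → IsSemialgebraicFunOn ℚ W fun z => fd a (T z) (Y z)) ∧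
    (∀ {d : ℕ} {W : Set (Fin d → ℝ)}, IsSemialgebraic ℚ W → ∀ (b : Fin (m + 2)) {T Y : (Fin d → ℝ) → ℝ}, IsSemialgebraicFunOn ℚ W T → IsSemialgebraicFunOn ℚ W Y → IsSemialgebraicFunOn ℚ W fun z => gd b (T z) (Y z)) ∧
    (∀ {d : ℕ} {W : Set (Fin d → ℝ)}, IsSemialgebraic ℚ W → ∀ (a : Fin (m + 2)) {T Y : (Fin d → ℝ) → ℝ}, IsSemialgebraicFunOn ℚ W T → IsSemialgebraicFunOn ℚ W Y → IsSemialgebraicFunOn ℚ W fun z => dd a (T z) (Y z)) ∧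
    (∀ {d : ℕ} {W : Set (Fin d → ℝ)}, IsSemialgebraic ℚ W → ∀ {n : ℕ} (U : Fin n → Fin (m + 2)) {X : (Fin d → ℝ) → Fin n → ℝ} {P Q : (Fin d → ℝ) → ℝ}, (∀ i, IsSemialgebraicFunOn ℚ W fun z => X z i) → IsSemialgebraicFunOn ℚ W P → IsSemialgebraicFunOn ℚ W Q → IsSemialgebraicFunOn ℚ W fun z => Ht U (X z) (P z) (Q z)) ∧
    (∀ {d : ℕ} {W : Set (Fin d → ℝ)}, IsSemialgebraic ℚ W → ∀ {n : ℕ} (V : Fin n → Fin (m + 2)) {Y : (Fin d → ℝ) → Fin n → ℝ} {P Q : (Fin d → ℝ) → ℝ}, (∀ i, IsSemialgebraicFunOn ℚ W fun z => Y z i) → IsSemialgebraicFunOn ℚ W P → IsSemialgebraicFunOn ℚ W Q → IsSemialgebraicFunOn ℚ W fun z => Vt V (Y z) (P z) (Q z)) ∧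
    (∀ {d : ℕ} {W : Set (Fin d → ℝ)}, IsSemialgebraic ℚ W → ∀ {n : ℕ} (U : Fin n → Fin (m + 2)) {X : (Fin d → ℝ) → Fin n → ℝ} {P Q : (Fin d → ℝ) → ℝ}, (∀ i, IsSemialgebraicFunOn ℚ W fun z => X z i) → IsSemialgebraicFunOn ℚ W P → IsSemialgebraicFunOn ℚ W Q → IsSemialgebraicFunOn ℚ W fun z => dHt U (X z) (P z) (Q z)) ∧
    (∀ {d : ℕ} {W : Set (Fin d → ℝ)}, IsSemialgebraic ℚ W → ∀ {n : ℕ} (V : Fin n → Fin (m + 2)) {Y : (Fin d → ℝ) → Fin n → ℝ} {P Q : (Fin d → ℝ) → ℝ}, (∀ i, IsSemialgebraicFunOn ℚ W fun z => Y z i) → IsSemialgebraicFunOn ℚ W P → IsSemialgebraicFunOn ℚ W Q → IsSemialgebraicFunOn ℚ W fun z => dVt V (Y z) (P z) (Q z)) ∧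
    (∃ C : ℝ, ∀ (a : Fin (m + 2)) (ξ η : ℝ), 0 ≤ ξ → ξ ≤ (α : ℝ) → 0 ≤ η → η ≤ (β : ℝ) → (a ≠ ℓ → |fd a ξ η| ≤ C) ∧ (a ≠ ℓ' → |gd a ξ η| ≤ C) ∧ |dd a ξ η| ≤ C ∧ (∀ η' : ℝ, 0 ≤ η' → η' ≤ (β : ℝ) → |fd a ξ η - fd a ξ η'| ≤ C * |η - η'|) ∧ (∀ ξ' : ℝ, 0 ≤ ξ' → ξ' ≤ (α : ℝ) → |gd a ξ η - gd a ξ' η| ≤ C * |ξ - ξ'|)) ∧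
    (∀ k : ℕ, ∃ C : ℝ, ∀ (U : Fin k → Fin (m + 2)) (x : Fin k → ℝ) (ξ η : ℝ), (∀ i, 0 ≤ x i ∧ x i ≤ 1) → 0 ≤ ξ → ξ ≤ (α : ℝ) → 0 ≤ η → η ≤ (β : ℝ) → |Ht U x ξ η| ≤ C ∧ |dHt U x ξ η| ≤ C ∧ (0 < k → |Ht U x ξ η| ≤ C * ξ) ∧ (∀ η' : ℝ, 0 ≤ η' → η' ≤ (β : ℝ) → |Ht U x ξ η - Ht U x ξ η'| ≤ C * ξ * |η - η'|)) ∧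
    (∀ l : ℕ, ∃ C : ℝ, ∀ (V : Fin l → Fin (m + 2)) (y : Fin l → ℝ) (ξ η : ℝ), (∀ i, 0 ≤ y i ∧ y i ≤ 1) → 0 ≤ ξ → ξ ≤ (α : ℝ) → 0 ≤ η → η ≤ (β : ℝ) → |Vt V y ξ η| ≤ C ∧ |dVt V y ξ η| ≤ C ∧ (0 < l → |Vt V y ξ η| ≤ C * η) ∧ (∀ ξ' : ℝ, 0 ≤ ξ' → ξ' ≤ (α : ℝ) → |Vt V y ξ η - Vt V y ξ' η| ≤ C * η * |ξ - ξ'|)))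

/-! ### A three-factor bound -/

/-- `|a (b c)| ≤ A (B C)` from `|a| ≤ A`, `|b| ≤ B`, `|c| ≤ C`. [folklore] -/
theorem abs_mul_mul_le {a b c A B C : ℝ} (ha : |a| ≤ A) (hb : |b| ≤ B) (hc : |c| ≤ C) :
    |a * (b * c)| ≤ A * (B * C) := by
  rw [abs_mul, abs_mul]
  exact mul_le_mul ha (mul_le_mul hb hc (abs_nonneg _) ((abs_nonneg _).trans hb)) (by positivity)
    ((abs_nonneg _).trans ha)

/-! ### The bounded families of Step A -/

include H in
/-- **The bounded families of Step A exist** for normalised data: the IH family `P a`, the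
`dd`-terms `W₁ a` and the `dB`-terms `W₂ a` (letters `a ≠ ℓ`), and the IH families `Φ c`, `Φ₂ a b`
of the two collections (all bounded on the closed cube). [folklore] -/
theorem exists_stepA_bdd (μ : (DrinfeldKohnoTrunc ℚ (Fin 4) N) →ₗ[ℚ] ℚ) (e : ℕ) (Ξ Η σ : (Fin e → ℝ) → ℝ)
    (hΞΗ : ∀ θ ∈ KZ.cube e, 0 ≤ Ξ θ ∧ Ξ θ ≤ (α : ℝ) ∧ 0 ≤ Η θ ∧ Η θ ≤ (β : ℝ))
    (hsaΞ : IsSemialgebraicFunOn ℚ (KZ.cube e) Ξ) (hsaΗ : IsSemialgebraicFunOn ℚ (KZ.cube e) Η)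
    (hsaσ : IsSemialgebraicFunOn ℚ (KZ.cube e) σ) (hb : ∃ C : ℝ, ∀ θ ∈ KZ.cube e, |σ θ| * Ξ θ * Η θ ≤ C)
    (hσ0 : ∀ θ ∈ KZ.cube e, Ξ θ = 0 ∨ Η θ = 0 → σ θ = 0)
    (Ξ₁ Η₁ ρ : (Fin (e + 1) → ℝ) → ℝ) (σw : Fin (m + 2) → (Fin (e + 1) → ℝ) → ℝ)
    (hΞ₁ : ∀ θ', Ξ₁ θ' = Ξ (Fin.init θ') * θ' (Fin.last e)) (hΗ₁ : ∀ θ', Η₁ θ' = Η (Fin.init θ'))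
    (hρ : ∀ θ', ρ θ' = σ (Fin.init θ') * Ξ (Fin.init θ'))
    (hσw : ∀ a θ', σw a θ' = ρ θ' * fd a (Ξ₁ θ') (Η₁ θ'))
    (Ξ₂ Η₂ ρ₂ : (Fin (e + 2) → ℝ) → ℝ)
    (hΞ₂ : ∀ θ'', Ξ₂ θ'' = Ξ (Fin.init (Fin.init θ'')) * θ'' (Fin.castSucc (Fin.last e)))
    (hΗ₂ : ∀ θ'', Η₂ θ'' = Η (Fin.init (Fin.init θ'')) * θ'' (Fin.last (e + 1)))
    (hρ₂ : ∀ θ'', ρ₂ θ'' = σ (Fin.init (Fin.init θ'')) * Ξ (Fin.init (Fin.init θ'')) * Η (Fin.init (Fin.init θ'')))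
    (k l : ℕ) :
    (∀ a, ∃ P : KZ.IntegralRep (k + l + (e + 1)), P.domain = KZ.cube (k + l + (e + 1)) ∧
      P.integrand = fun w => σw a (Θb k l (e + 1) w) *
        F (μ ∘ₗ op a) (Xb k l (e + 1) w) (Yb k l (e + 1) w) (Ξ₁ (Θb k l (e + 1) w)) (Η₁ (Θb k l (e + 1) w))) ∧
    (∀ a, ∃ W₁ : KZ.IntegralRep (k + l + (e + 2)), W₁.domain = KZ.cube (k + l + (e + 2)) ∧ (a ≠ ℓ →
      W₁.integrand = fun w => ρ₂ (Θb k l (e + 2) w) *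
        (dd a (Ξ₂ (Θb k l (e + 2) w)) (Η₂ (Θb k l (e + 2) w)) *
          Bf (μ ∘ₗ op a) (Xb k l (e + 2) w) (Yb k l (e + 2) w) (Ξ₂ (Θb k l (e + 2) w)) (Η₂ (Θb k l (e + 2) w))))) ∧
    (∀ a, ∃ W₂ : KZ.IntegralRep (k + l + (e + 2)), W₂.domain = KZ.cube (k + l + (e + 2)) ∧ (a ≠ ℓ →
      W₂.integrand = fun w => ρ₂ (Θb k l (e + 2) w) *
        (fd a (Ξ₂ (Θb k l (e + 2) w)) (Η₂ (Θb k l (e + 2) w)) *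
          dBf (μ ∘ₗ op a) (Xb k l (e + 2) w) (Yb k l (e + 2) w) (Ξ₂ (Θb k l (e + 2) w)) (Η₂ (Θb k l (e + 2) w))))) ∧
    (∀ c, ∃ Φ : KZ.IntegralRep (k + l + (e + 2)), Φ.domain = KZ.cube (k + l + (e + 2)) ∧
      Φ.integrand = fun w => ρ₂ (Θb k l (e + 2) w) * dd c (Ξ₂ (Θb k l (e + 2) w)) (Η₂ (Θb k l (e + 2) w)) *
        F (μ ∘ₗ op c) (Xb k l (e + 2) w) (Yb k l (e + 2) w) (Ξ₂ (Θb k l (e + 2) w)) (Η₂ (Θb k l (e + 2) w))) ∧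
    (∀ a b, ∃ Φ₂ : KZ.IntegralRep (k + l + (e + 2)), Φ₂.domain = KZ.cube (k + l + (e + 2)) ∧
      Φ₂.integrand = fun w => ρ₂ (Θb k l (e + 2) w) *
        (fd a (Ξ₂ (Θb k l (e + 2) w)) (Η₂ (Θb k l (e + 2) w)) * gd b (Ξ₂ (Θb k l (e + 2) w)) (Η₂ (Θb k l (e + 2) w))) *
        F ((μ ∘ₗ opV b) ∘ₗ op a) (Xb k l (e + 2) w) (Yb k l (e + 2) w) (Ξ₂ (Θb k l (e + 2) w)) (Η₂ (Θb k l (e + 2) w))) := by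
  obtain ⟨⟨saΞ₁, saΗ₁, saσw, hr₁, hbw⟩, saΞ₂, saΗ₂, saρ₂, hr₂, -, -⟩ :=
    exists_stepA_adm H μ e Ξ Η σ hΞΗ hsaΞ hsaΗ hsaσ hb hσ0 Ξ₁ Η₁ ρ σw hΞ₁ hΗ₁ hρ hσw Ξ₂ Η₂ ρ₂ hΞ₂ hΗ₂ hρ₂ k l
  obtain ⟨Kf, hKf0, hKf⟩ := abs_fd_mul_le H
  obtain ⟨Kg, _, hKg⟩ := abs_gd_mul_le H
  obtain ⟨C₀, hC₀⟩ := hb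
  have hW := fun d => KZ.isSemialgebraic_cube (n := d)
  -- the semialgebraic ingredients on the big cubes `[0,1]^{k+l+(e+1)}` and `[0,1]^{k+l+(e+2)}`
  have sX₁ := fun i => sa_Xb H (k := k) (l := l) (e := e + 1) i
  have sY₁ := fun j => sa_Yb H (k := k) (l := l) (e := e + 1) j
  have sΞ₁ := sa_Θb H (k := k) (l := l) saΞ₁
  have sΗ₁ := sa_Θb H (k := k) (l := l) saΗ₁
  have sσw := fun a => sa_Θb H (k := k) (l := l) (saσw a)
  have sX₂ := fun i => sa_Xb H (k := k) (l := l) (e := e + 2) i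
  have sY₂ := fun j => sa_Yb H (k := k) (l := l) (e := e + 2) j
  have sΞ₂ := sa_Θb H (k := k) (l := l) saΞ₂
  have sΗ₂ := sa_Θb H (k := k) (l := l) saΗ₂
  have sρ₂ := sa_Θb H (k := k) (l := l) saρ₂
  have hsaF₁ := fun ν => sa_F H (hW _) ν sX₁ sY₁ sΞ₁ sΗ₁
  have hsaF₂ := fun ν => sa_F H (hW _) ν sX₂ sY₂ sΞ₂ sΗ₂
  have hsaB₂ := fun ν => qe_sa_Bf H (hW _) ν sX₂ sY₂ sΞ₂ sΗ₂
  have hsadB₂ := fun ν => sa_dBf H (hW _) ν sX₂ sY₂ sΞ₂ sΗ₂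
  -- bounds for the transports, blocks of cube points
  have hF := fun ν => abs_F_le H ν k l
  have hB := fun ν => abs_Bf_le H ν k l
  have hdB := fun ν => abs_dBf_le H ν k l
  have hmem₁ := fun (z : Fin (k + l + (e + 1)) → ℝ) (hz : z ∈ KZ.cube (k + l + (e + 1))) => Xb_Yb_Θb_mem H hz
  have hmem₂ := fun (z : Fin (k + l + (e + 2)) → ℝ) (hz : z ∈ KZ.cube (k + l + (e + 2))) => Xb_Yb_Θb_mem H hz
  obtain ⟨_, _, _, _, _, _, _, _, _, _, _, _, _, _, _, _, _, _, _, _, _, _, _, _, _, _, _, _, _, _, _, _, _, _, _, _,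
    _, hsa_fd, hsa_gd, hsa_dd, _, _, _, _, hbd_letters, -⟩ := H
  obtain ⟨Cb, hCb⟩ := hbd_letters
  -- a representation of the right dimension, for the vacuous cases
  obtain ⟨R₀, hR₀, -⟩ := CornerReps.exists_rep_cube (d := k + l + (e + 2)) (fun _ => (0 : ℝ)) (sa_zero (hW _))
    ⟨0, fun _ _ => by rw [abs_zero]⟩
  refine ⟨fun a => ?_, fun a => ?_, fun a => ?_, fun c => ?_, fun a b => ?_⟩
  · -- the IH family `P a`: `|σ_a F| ≤ |σ_a| K Ξ₁ Η₁ ≤ K C_a`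
    obtain ⟨K, hK0, hK⟩ := hF (μ ∘ₗ op a)
    obtain ⟨Ca, hCa⟩ := hbw a
    refine CornerReps.exists_rep_cube _ ((sσw a).fun_mul (hsaF₁ (μ ∘ₗ op a))) ⟨K * Ca, fun w hw => ?_⟩
    obtain ⟨hx, hy, hθ⟩ := hmem₁ w hw
    obtain ⟨h10, h1α, h1η0, h1β⟩ := hr₁ _ hθ
    rw [abs_mul]
    calc _ ≤ |σw a (Θb k l (e + 1) w)| * (K * Ξ₁ (Θb k l (e + 1) w) * Η₁ (Θb k l (e + 1) w)) :=
        mul_le_mul_of_nonneg_left (hK _ _ _ _ hx hy h10 h1α h1η0 h1β) (abs_nonneg _)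
      _ = K * (|σw a (Θb k l (e + 1) w)| * Ξ₁ (Θb k l (e + 1) w) * Η₁ (Θb k l (e + 1) w)) := by ring
      _ ≤ K * Ca := mul_le_mul_of_nonneg_left (hCa _ hθ) hK0
  · -- the `dd`-terms `W₁ a`: all three factors are bounded
    obtain ⟨K, _, hK⟩ := hB (μ ∘ₗ op a)
    obtain ⟨W₁, hW₁, hW₁i⟩ := CornerReps.exists_rep_cube _ (sρ₂.fun_mul
      ((hsa_dd (hW _) a sΞ₂ sΗ₂).fun_mul (hsaB₂ (μ ∘ₗ op a)))) ⟨C₀ * (|Cb| * K), fun w hw => by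
        obtain ⟨hx, hy, hθ⟩ := hmem₂ w hw
        obtain ⟨h20, h2α, h2η0, h2β⟩ := hr₂ _ hθ
        exact abs_mul_mul_le (abs_rho2_le hΞΗ hC₀ ρ₂ hρ₂ hθ).1
          ((hCb a _ _ h20 h2α h2η0 h2β).2.2.1.trans (le_abs_self _)) (hK _ _ _ _ hx hy h20 h2α h2η0 h2β)⟩
    exact ⟨W₁, hW₁, fun _ => hW₁i⟩
  · -- the `dB`-terms `W₂ a` (`a ≠ ℓ`; for `a = ℓ` nothing is required of the integrand)
    by_cases ha : a = ℓ
    · exact ⟨R₀, hR₀, fun h => absurd ha h⟩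
    obtain ⟨K, _, hK⟩ := hdB (μ ∘ₗ op a)
    obtain ⟨W₂, hW₂, hW₂i⟩ := CornerReps.exists_rep_cube _ (sρ₂.fun_mul
      ((hsa_fd (hW _) a sΞ₂ sΗ₂).fun_mul (hsadB₂ (μ ∘ₗ op a)))) ⟨C₀ * (|Cb| * K), fun w hw => by
        obtain ⟨hx, hy, hθ⟩ := hmem₂ w hw
        obtain ⟨h20, h2α, h2η0, h2β⟩ := hr₂ _ hθ
        exact abs_mul_mul_le (abs_rho2_le hΞΗ hC₀ ρ₂ hρ₂ hθ).1
          (((hCb a _ _ h20 h2α h2η0 h2β).1 ha).trans (le_abs_self _)) (hK _ _ _ _ hx hy h20 h2α h2η0 h2β)⟩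
    exact ⟨W₂, hW₂, fun _ => hW₂i⟩
  · -- the IH family `Φ c`: `|ρ₂ dd_c F| ≤ C₀ |C| K α β`
    obtain ⟨K, hK0, hK⟩ := hF (μ ∘ₗ op c)
    refine CornerReps.exists_rep_cube _ ((sρ₂.fun_mul (hsa_dd (hW _) c sΞ₂ sΗ₂)).fun_mul (hsaF₂ (μ ∘ₗ op c)))
      ⟨C₀ * (|Cb| * (K * |(α : ℝ)| * |(β : ℝ)|)), fun w hw => ?_⟩
    obtain ⟨hx, hy, hθ⟩ := hmem₂ w hw
    obtain ⟨h20, h2α, h2η0, h2β⟩ := hr₂ _ hθ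
    rw [mul_assoc]
    refine abs_mul_mul_le (abs_rho2_le hΞΗ hC₀ ρ₂ hρ₂ hθ).1
      ((hCb c _ _ h20 h2α h2η0 h2β).2.2.1.trans (le_abs_self _)) ((hK _ _ _ _ hx hy h20 h2α h2η0 h2β).trans ?_)
    exact mul_le_mul (mul_le_mul_of_nonneg_left (h2α.trans (le_abs_self _)) hK0) (h2β.trans (le_abs_self _))
      h2η0 (by positivity)
  · -- the IH family `Φ₂ a b`: `|ρ₂ fd_a gd_b F| ≤ |ρ₂| (|fd_a| Ξ₂) (|gd_b| Η₂) K ≤ C₀ K_f K_g K`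
    obtain ⟨K, hK0, hK⟩ := hF ((μ ∘ₗ opV b) ∘ₗ op a)
    refine CornerReps.exists_rep_cube _ ((sρ₂.fun_mul ((hsa_fd (hW _) a sΞ₂ sΗ₂).fun_mul
      (hsa_gd (hW _) b sΞ₂ sΗ₂))).fun_mul (hsaF₂ ((μ ∘ₗ opV b) ∘ₗ op a))) ⟨C₀ * (Kf * Kg) * K, fun w hw => ?_⟩
    obtain ⟨hx, hy, hθ⟩ := hmem₂ w hw
    obtain ⟨h20, h2α, h2η0, h2β⟩ := hr₂ _ hθ
    obtain ⟨hρa, hC0⟩ := abs_rho2_le hΞΗ hC₀ ρ₂ hρ₂ hθ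
    have hFw := hK _ _ _ _ hx hy h20 h2α h2η0 h2β
    rw [abs_mul, abs_mul, abs_mul]
    calc |ρ₂ (Θb k l (e + 2) w)| * (|fd a (Ξ₂ (Θb k l (e + 2) w)) (Η₂ (Θb k l (e + 2) w))| *
          |gd b (Ξ₂ (Θb k l (e + 2) w)) (Η₂ (Θb k l (e + 2) w))|) *
          |F ((μ ∘ₗ opV b) ∘ₗ op a) (Xb k l (e + 2) w) (Yb k l (e + 2) w) (Ξ₂ (Θb k l (e + 2) w))
            (Η₂ (Θb k l (e + 2) w))|
        ≤ |ρ₂ (Θb k l (e + 2) w)| * (|fd a (Ξ₂ (Θb k l (e + 2) w)) (Η₂ (Θb k l (e + 2) w))| *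
          |gd b (Ξ₂ (Θb k l (e + 2) w)) (Η₂ (Θb k l (e + 2) w))|) *
          (K * Ξ₂ (Θb k l (e + 2) w) * Η₂ (Θb k l (e + 2) w)) :=
        mul_le_mul_of_nonneg_left hFw (by positivity)
      _ = |ρ₂ (Θb k l (e + 2) w)| * ((|fd a (Ξ₂ (Θb k l (e + 2) w)) (Η₂ (Θb k l (e + 2) w))| *
          Ξ₂ (Θb k l (e + 2) w)) * (|gd b (Ξ₂ (Θb k l (e + 2) w)) (Η₂ (Θb k l (e + 2) w))| *
          Η₂ (Θb k l (e + 2) w))) * K := by ring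
      _ ≤ C₀ * (Kf * Kg) * K :=
        mul_le_mul_of_nonneg_right (mul_le_mul hρa (mul_le_mul (hKf a _ _ h20 h2α h2η0 h2β)
          (hKg b _ _ h20 h2α h2η0 h2β) (by positivity) hKf0) (by positivity) hC0) hK0

end AbstractEngine

/-- **Hook `cornerEngineExistBdd_abs_mul_mul_le`** (registered form of `abs_mul_mul_le`): a bound for
a product of three factors. [folklore] -/
theorem cornerEngineExistBdd_abs_mul_mul_le : ∀ (a b c A B C : ℝ), |a| ≤ A → |b| ≤ B → |c| ≤ C → |a * (b * c)| ≤ A * (B * C) :=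
  fun _ _ _ _ _ _ ha hb hc => abs_mul_mul_le ha hb hc

end Summit.KontsevichZagierPeriods.FurushoPentagon.PentagonInKZ
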